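import Summits.QuantumFields.QCD.Theses.PauliWegnerSea
import Summits.QuantumFields.QCD.Theorems.MobilityGap.Negative.LowerPin

/-!
# `PauliWegnerSea.OneScaleTrajectory` (stmt-QuantumFields-11513): the content sits in clause (iii)

Support file (prover, item-scoped) for the legacy support item
`Summit.QuantumFields.QCD.Theses.PauliWegnerSea.OneScaleTrajectory` — the trajectory crux of route
`PauliWegnerSea` before the statement re-type of 2026-08-16, now superseded as load-bearing by
`ChiralOneScaleTrajectory` (stmt-QuantumFields-17512).  Sorry-free, no new definitions (the clause
abbreviations `bare`, `fm`, `ClauseI`, `Lower`, `Sign` and the lattice-heavy regularisation `heavyReg`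
are those of the sibling crux `MobilityGap`, file `Theorems/MobilityGap/Negative/LowerPin.lean`,
whose clauses (i), (iii), (iv) are byte-identical to this item's):

* `oneScaleTrajectory_iff_clauses` — the item re-read clause by clause in that vocabulary
  (`Iff.rfl`): both scalings, (i) `ClauseI`, the ONE-SCALE input (written out through `fm`), (iii)
  `Lower`, (iv) `Sign`.
* `oneScaleTrajectory_of_chiralOneScaleTrajectory` — the live crux `ChiralOneScaleTrajectory`
  implies this item by forgetting the conjunct `reg.IsChiralAtZero` (so the item closes by one line
  the day stmt-QuantumFields-17512 lands).
* `oneScaleTrajectory_witness_window` — by `LowerPin`, clause (iii) alone forces every witness to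
  keep its bare masses in `|m_f(k) + 4| < 41/10` and `m_crit(k) < 1/10` eventually.
* `heavyReg_oneScale`, `oneScaleTrajectory_without_lower_holds` — the item WITH CLAUSE (iii)
  DELETED holds outright, witnessed by `heavyReg` (`a_k = 1/(k+1)`, `L_k = (k+1)²`,
  `β_k = afBeta N_f 1 a_k`, `m_crit ≡ 1`): the one-scale clause is met at the shell `ℓ₀ = k + 1`
  (`ℓ₀ a_k = 1`, `K₀ = 1`, `s = 1/2`) by the landed hopping bound `stub_hopping` at LATTICE rate,
  which beats the polynomial losses `ℓ₀^q (1+|β_k|)^q` (`1 + |β_k| = O((k+1)²)`, two-loop profile);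
  (i) and (iv) as in `mobilityGapWithoutLower_holds`.  With `heavyReg_not_lower` (LowerPin) this
  certifies, for this item exactly as for `MobilityGap`: both scalings, (i), the one-scale input and
  (iv) are jointly content-free; everything enters through the LOWER bound (iii) (quarks not
  lattice-heavy), i.e. through proving the localisation input at LIGHT bare masses.
-/

noncomputable section

namespace Summit.QuantumFields.QCD.Theorems.OneScaleTrajectoryContent

open scoped BigOperators Topology
open MeasureTheory Filter Set
open Literature.MathematicalPhysics.QuantumFieldTheory Literature.MathematicalPhysics.QuantumLattice
  Literature.Probability.LatticeModels
open Summit.QuantumFields.QCD.Theorems.MobilityGapNegative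
open Summit.QuantumFields.QCD.Theses.PauliWegnerSea (OneScaleTrajectory ChiralOneScaleTrajectory)

variable {Nf : ℕ}

/-- **The item, clause by clause** (definitional re-reading in the vocabulary of
`MobilityGap/Negative/LowerPin.lean`): `OneScaleTrajectory` says that for `N_f ∈ {2,3}` some
regularisation has both scalings and, for every positive mass tuple, (i) `ClauseI`, the one-scale
input (some log-scale shell `ℓ₀ ≤ L_k`, `ℓ₀ a_k ≤ K₀ (1 + |log a_k|)`, carries
`ℓ₀^q (1+|β_k|)^q · fm ≤ 1`), (iii) `Lower` and (iv) `Sign`. -/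
theorem oneScaleTrajectory_iff_clauses :
    OneScaleTrajectory ↔
      ∀ Nf : ℕ, Nf = 2 ∨ Nf = 3 → ∃ reg : QCDRegularisation Nf,
        reg.HasMassScaling ∧ (reg.scheme 0 0 0).HasAsymptoticScaling ∧
          ∀ m : Fin Nf → ℝ, (∀ f, 0 < m f) →
            ClauseI reg m ∧
            (∀ q : ℕ, ∃ K₀ s : ℝ, 0 < s ∧ s < 1 ∧ ∀ᶠ k in atTop, ∃ ℓ₀ : ℕ, 1 ≤ ℓ₀ ∧ ℓ₀ ≤ reg.L k ∧
              (ℓ₀ : ℝ) * reg.a k ≤ K₀ * (1 + |Real.log (reg.a k)|) ∧ ∀ S : ℕ, reg.L k ≤ S →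
                ∀ (f : Fin Nf) (v : Site 4), v ∈ box 4 S → ‖v‖ = (ℓ₀ : ℝ) →
                  (ℓ₀ : ℝ) ^ q * (1 + |reg.β k|) ^ q * fm Nf (reg.β k) (bare reg m k) S f v s ≤ 1) ∧
            Lower reg m ∧ Sign reg m :=
  Iff.rfl

/-- **The live crux implies the legacy item by forgetting.** `ChiralOneScaleTrajectory`
(stmt-QuantumFields-17512) is `OneScaleTrajectory` with the extra conjunct `reg.IsChiralAtZero`
inside the existential; dropping it gives the item. -/
theorem oneScaleTrajectory_of_chiralOneScaleTrajectory (h : ChiralOneScaleTrajectory) :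
    OneScaleTrajectory := by
  intro Nf hNf
  obtain ⟨reg, hMS, -, hAS, hm⟩ := h Nf hNf
  exact ⟨reg, hMS, hAS, hm⟩

/-- **Every witness keeps its quarks out of the hopping region.** If `OneScaleTrajectory` holds,
then for `N_f ∈ {2,3}` it has a witness all of whose realised bare masses satisfy
`|m_f(k) + 4| < 41/10` eventually and whose critical mass is `< 1/10` eventually, for every positive
mass tuple — clause (iii) alone does this (`eventually_window_of_lower`,
`eventually_mcrit_lt_of_lower`). -/
theorem oneScaleTrajectory_witness_window (h : OneScaleTrajectory) :
    ∀ Nf : ℕ, Nf = 2 ∨ Nf = 3 → ∃ reg : QCDRegularisation Nf,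
      reg.HasMassScaling ∧ (reg.scheme 0 0 0).HasAsymptoticScaling ∧
        ∀ m : Fin Nf → ℝ, (∀ f, 0 < m f) → Lower reg m ∧ ∀ f : Fin Nf,
          (∀ᶠ k in atTop, |reg.mcrit k + reg.a k * m f / reg.Zm k + 4| < 41 / 10) ∧
          (∀ᶠ k in atTop, reg.mcrit k < 1 / 10) := by
  intro Nf hNf
  obtain ⟨reg, hMS, hAS, hm⟩ := oneScaleTrajectory_iff_clauses.1 h Nf hNf
  refine ⟨reg, hMS, hAS, fun m hmpos => ?_⟩
  have hL : Lower reg m := (hm m hmpos).2.2.1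
  exact ⟨hL, fun f => ⟨eventually_window_of_lower reg m hL f,
    eventually_mcrit_lt_of_lower reg m hmpos hL f⟩⟩

/-! ### The item minus clause (iii) holds outright (lattice-heavy witness) -/

/-- Growth constant of the two-loop profile: `B N_f = 1 + 2|b₀| + 2|b₁/b₀|`. -/
theorem betaBound_pos (Nf : ℕ) : 0 < 1 + 2 * |betaCoeff₀ Nf| + 2 * |betaCoeff₁ Nf / betaCoeff₀ Nf| := by
  positivity

/-- Along `heavyReg` (`β_k = afBeta N_f 1 (k+1)⁻¹ = 2b₀ ℓ + 2(b₁/b₀) log ℓ`, `ℓ = log (k+1)²`),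
`1 + |β_k| ≤ (1 + 2|b₀| + 2|b₁/b₀|) (k+1)²` for `k ≥ 1` (then `1 ≤ ℓ ≤ (k+1)²`, `0 ≤ log ℓ ≤ ℓ`). -/
theorem one_add_abs_beta_le (Nf : ℕ) {k : ℕ} (hk : 1 ≤ k) :
    1 + |(heavyReg Nf).β k| ≤
      (1 + 2 * |betaCoeff₀ Nf| + 2 * |betaCoeff₁ Nf / betaCoeff₀ Nf|) * ((k : ℝ) + 1) ^ 2 := by
  have hβ : (heavyReg Nf).β k = afBeta Nf 1 (((k : ℝ) + 1)⁻¹) := rfl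
  have hk1 : (1 : ℝ) ≤ k := by exact_mod_cast hk
  set y : ℝ := ((k : ℝ) + 1) ^ 2 with hy
  have hy4 : 4 ≤ y := by rw [hy]; nlinarith
  have hyarg : 1 / ((((k : ℝ) + 1)⁻¹) ^ 2 * (1 : ℝ) ^ 2) = y := by
    rw [hy, one_pow, mul_one, inv_pow, one_div, inv_inv]
  set ℓ : ℝ := Real.log y with hℓ
  have hypos : 0 < y := by linarith
  have hℓy : ℓ ≤ y := (Real.log_le_sub_one_of_pos hypos).trans (by linarith)
  have hℓ1 : 1 ≤ ℓ := by
    rw [hℓ, ← Real.log_exp 1]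
    exact Real.log_le_log (Real.exp_pos 1) (by linarith [Real.exp_one_lt_three])
  have hℓpos : 0 < ℓ := by linarith
  have hlog0 : 0 ≤ Real.log ℓ := Real.log_nonneg hℓ1
  have hlogℓ : Real.log ℓ ≤ y := ((Real.log_le_sub_one_of_pos hℓpos).trans (by linarith)).trans hℓy
  have h1 : |afBeta Nf 1 (((k : ℝ) + 1)⁻¹)| ≤
      (2 * |betaCoeff₀ Nf| + 2 * |betaCoeff₁ Nf / betaCoeff₀ Nf|) * y := by
    unfold afBeta
    rw [hyarg, ← hℓ]
    refine (abs_add_le _ _).trans ?_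
    rw [abs_mul, abs_mul, abs_mul, abs_mul, abs_of_pos hℓpos, abs_of_nonneg hlog0,
      abs_of_pos (two_pos : (0 : ℝ) < 2)]
    have ha := abs_nonneg (betaCoeff₀ Nf)
    have hb := abs_nonneg (betaCoeff₁ Nf / betaCoeff₀ Nf)
    nlinarith [mul_le_mul_of_nonneg_left hℓy ha, mul_le_mul_of_nonneg_left hlogℓ hb]
  rw [hβ]
  have hy1 : 1 ≤ y := by linarith
  nlinarith [h1, abs_nonneg (betaCoeff₀ Nf), abs_nonneg (betaCoeff₁ Nf / betaCoeff₀ Nf)]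

/-- The race won by the lattice rate: for `c > 0`, any `A` and any degree `d`, eventually
`(k+1)^d · A e^{-c (k+1)} ≤ 1`. -/
theorem eventually_pow_mul_exp_le_one (d : ℕ) {c : ℝ} (hc : 0 < c) (A : ℝ) :
    ∀ᶠ k : ℕ in atTop, ((k : ℝ) + 1) ^ d * (A * Real.exp (-(c * ((k : ℝ) + 1)))) ≤ 1 := by
  -- `x ↦ x^d e^{-x} → 0` at `+∞`, composed with `x_k = c (k+1) → +∞`
  have hx : Tendsto (fun k : ℕ => c * ((k : ℝ) + 1)) atTop atTop :=
    (tendsto_natCast_atTop_atTop.atTop_add tendsto_const_nhds).const_mul_atTop hc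
  have h0 : Tendsto (fun k : ℕ => (c * ((k : ℝ) + 1)) ^ d * Real.exp (-(c * ((k : ℝ) + 1))))
      atTop (𝓝 0) :=
    (Real.tendsto_pow_mul_exp_neg_atTop_nhds_zero d).comp hx
  have h1 := h0.const_mul (A / c ^ d)
  rw [mul_zero] at h1
  filter_upwards [h1.eventually (eventually_le_nhds one_pos)] with k hk
  have hcd : c ^ d ≠ 0 := pow_ne_zero _ hc.ne'
  have e : ((k : ℝ) + 1) ^ d * (A * Real.exp (-(c * ((k : ℝ) + 1)))) =
      A / c ^ d * ((c * ((k : ℝ) + 1)) ^ d * Real.exp (-(c * ((k : ℝ) + 1)))) := by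
    rw [mul_pow, div_mul_eq_mul_div, eq_div_iff hcd]
    ring
  rw [e]
  exact hk

/-- **The one-scale input holds for `heavyReg`** (every positive mass tuple): for every `q`, with
`K₀ = 1`, `s = 1/2` and the shell `ℓ₀ = k + 1` (`ℓ₀ a_k = 1 ≤ 1 + |log a_k|`, `1 ≤ ℓ₀ ≤ L_k = (k+1)²`),
the landed hopping bound `stub_hopping` (bare masses `≥ 1`, so `|m_f(k) + 4| ≥ 41/10`) gives
`fm ≤ C e^{-(μ/2)(k+1)}` on the shell, and `(k+1)^q (1+|β_k|)^q C e^{-(μ/2)(k+1)} ≤ 1` eventually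
since `1 + |β_k| ≤ B (k+1)²`. -/
theorem heavyReg_oneScale (m : Fin Nf → ℝ) (hm : ∀ f, 0 < m f) :
    ∀ q : ℕ, ∃ K₀ s : ℝ, 0 < s ∧ s < 1 ∧ ∀ᶠ k in atTop, ∃ ℓ₀ : ℕ, 1 ≤ ℓ₀ ∧ ℓ₀ ≤ (heavyReg Nf).L k ∧
      (ℓ₀ : ℝ) * (heavyReg Nf).a k ≤ K₀ * (1 + |Real.log ((heavyReg Nf).a k)|) ∧
        ∀ S : ℕ, (heavyReg Nf).L k ≤ S → ∀ (f : Fin Nf) (v : Site 4), v ∈ box 4 S → ‖v‖ = (ℓ₀ : ℝ) →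
          (ℓ₀ : ℝ) ^ q * (1 + |(heavyReg Nf).β k|) ^ q *
              fm Nf ((heavyReg Nf).β k) (bare (heavyReg Nf) m k) S f v s ≤ 1 := by
  intro q
  obtain ⟨C, μ, hC, hμ, hhop⟩ :=
    Summit.QuantumFields.QCD.Theorems.ThickCollarFarStability.stub_hopping Nf
  refine ⟨1, 1 / 2, by norm_num, by norm_num, ?_⟩
  have hμ2 : 0 < μ * (1 / 2) := by positivity
  set B : ℝ := 1 + 2 * |betaCoeff₀ Nf| + 2 * |betaCoeff₁ Nf / betaCoeff₀ Nf| with hB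
  have hBpos : 0 < B := betaBound_pos Nf
  filter_upwards [eventually_ge_atTop 1, eventually_pow_mul_exp_le_one (3 * q) hμ2 (B ^ q * C)]
    with k hk hrace
  refine ⟨k + 1, Nat.le_add_left 1 k, ?_, ?_, ?_⟩
  · -- `k + 1 ≤ L_k = (k+1)²`
    show k + 1 ≤ (k + 1) ^ 2
    nlinarith
  · -- `ℓ₀ a_k = 1 ≤ 1 + |log a_k|`
    have ha : (heavyReg Nf).a k = ((k : ℝ) + 1)⁻¹ := rfl
    have hk0 : (0 : ℝ) < (k : ℝ) + 1 := by positivity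
    rw [ha, Nat.cast_add_one, mul_inv_cancel₀ hk0.ne', one_mul]
    linarith [abs_nonneg (Real.log ((k : ℝ) + 1)⁻¹)]
  · intro S _ f v hv hnorm
    have hb := hhop ((heavyReg Nf).β k) (bare (heavyReg Nf) m k) f (heavyReg_bare_window m hm k f).2
      S (1 / 2) (by norm_num) (by norm_num) v hv
    rw [hnorm, Nat.cast_add_one] at hb
    -- `fm ≤ C e^{-(μ/2)(k+1)}`; polynomial prefactor `≤ (k+1)^q (B (k+1)²)^q = B^q (k+1)^{3q}`
    have hfm0 : 0 ≤ fm Nf ((heavyReg Nf).β k) (bare (heavyReg Nf) m k) S f v (1 / 2) := by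
      unfold fm
      refine div_nonneg (integral_nonneg fun U => ?_) (integral_nonneg fun U => norm_nonneg _)
      exact mul_nonneg (norm_nonneg _) (Real.rpow_nonneg (by positivity) _)
    have hβ : 1 + |(heavyReg Nf).β k| ≤ B * ((k : ℝ) + 1) ^ 2 := one_add_abs_beta_le Nf hk
    have hpoly : ((k + 1 : ℕ) : ℝ) ^ q * (1 + |(heavyReg Nf).β k|) ^ q ≤
        ((k : ℝ) + 1) ^ q * (B * ((k : ℝ) + 1) ^ 2) ^ q := by
      rw [Nat.cast_add_one]
      have h1 : 0 ≤ 1 + |(heavyReg Nf).β k| := by positivity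
      exact mul_le_mul_of_nonneg_left (pow_le_pow_left₀ h1 hβ q) (by positivity)
    calc ((k + 1 : ℕ) : ℝ) ^ q * (1 + |(heavyReg Nf).β k|) ^ q *
          fm Nf ((heavyReg Nf).β k) (bare (heavyReg Nf) m k) S f v (1 / 2)
        ≤ ((k : ℝ) + 1) ^ q * (B * ((k : ℝ) + 1) ^ 2) ^ q *
            (C * Real.exp (-(μ * (1 / 2) * ((k : ℝ) + 1)))) :=
          mul_le_mul hpoly hb hfm0 (by positivity)
      _ = ((k : ℝ) + 1) ^ (3 * q) * (B ^ q * C * Real.exp (-(μ * (1 / 2) * ((k : ℝ) + 1)))) := by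
          rw [mul_pow, ← pow_mul]; ring
      _ ≤ 1 := hrace

/-- **The item with clause (iii) deleted holds** — for `N_f ∈ {2,3}` (indeed for every `N_f`) the
lattice-heavy regularisation `heavyReg` has both scalings and satisfies, for every positive mass
tuple, (i), the one-scale input and (iv) (ratio `= 1`, Seiler positivity).  So, exactly as for the
sibling `MobilityGap` (`mobilityGapWithoutLower_holds`), the whole content of `OneScaleTrajectory` is
carried by the LOWER bound (iii); `heavyReg` itself violates (iii) (`heavyReg_not_lower`). -/
theorem oneScaleTrajectory_without_lower_holds :
    ∀ Nf : ℕ, Nf = 2 ∨ Nf = 3 → ∃ reg : QCDRegularisation Nf,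
      reg.HasMassScaling ∧ (reg.scheme 0 0 0).HasAsymptoticScaling ∧
        ∀ m : Fin Nf → ℝ, (∀ f, 0 < m f) →
          ClauseI reg m ∧
          (∀ q : ℕ, ∃ K₀ s : ℝ, 0 < s ∧ s < 1 ∧ ∀ᶠ k in atTop, ∃ ℓ₀ : ℕ, 1 ≤ ℓ₀ ∧ ℓ₀ ≤ reg.L k ∧
            (ℓ₀ : ℝ) * reg.a k ≤ K₀ * (1 + |Real.log (reg.a k)|) ∧ ∀ S : ℕ, reg.L k ≤ S →
              ∀ (f : Fin Nf) (v : Site 4), v ∈ box 4 S → ‖v‖ = (ℓ₀ : ℝ) →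
                (ℓ₀ : ℝ) ^ q * (1 + |reg.β k|) ^ q * fm Nf (reg.β k) (bare reg m k) S f v s ≤ 1) ∧
          Sign reg m := by
  intro Nf _
  refine ⟨heavyReg Nf, heavyReg_hasMassScaling, heavyReg_hasAsymptoticScaling,
    fun m hm => ⟨?_, heavyReg_oneScale m hm, ?_⟩⟩
  · -- (i)
    intro f
    exact Eventually.of_forall fun k => by linarith [(heavyReg_bare_window m hm k f).1]
  · -- (iv): ratio = 1
    refine Eventually.of_forall fun k => ?_
    rw [signRatio_eq_one_of_pos ((heavyReg Nf).β k) (bare (heavyReg Nf) m k)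
      fun f => by linarith [(heavyReg_bare_window m hm k f).1]]
    norm_num

/-- ... while `heavyReg` is NOT a witness of the item: it violates clause (iii) for every positive
mass tuple (`heavyReg_not_lower`), so it fails the clause package of `oneScaleTrajectory_iff_clauses`. -/
theorem heavyReg_not_clauses (hNf : 0 < Nf) (m : Fin Nf → ℝ) (hm : ∀ f, 0 < m f) :
    ¬ (ClauseI (heavyReg Nf) m ∧
        (∀ q : ℕ, ∃ K₀ s : ℝ, 0 < s ∧ s < 1 ∧ ∀ᶠ k in atTop, ∃ ℓ₀ : ℕ, 1 ≤ ℓ₀ ∧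
          ℓ₀ ≤ (heavyReg Nf).L k ∧
            (ℓ₀ : ℝ) * (heavyReg Nf).a k ≤ K₀ * (1 + |Real.log ((heavyReg Nf).a k)|) ∧
              ∀ S : ℕ, (heavyReg Nf).L k ≤ S → ∀ (f : Fin Nf) (v : Site 4), v ∈ box 4 S →
                ‖v‖ = (ℓ₀ : ℝ) →
                  (ℓ₀ : ℝ) ^ q * (1 + |(heavyReg Nf).β k|) ^ q *
                    fm Nf ((heavyReg Nf).β k) (bare (heavyReg Nf) m k) S f v s ≤ 1) ∧
        Lower (heavyReg Nf) m ∧ Sign (heavyReg Nf) m) :=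
  fun h => heavyReg_not_lower hNf m hm h.2.2.1

end Summit.QuantumFields.QCD.Theorems.OneScaleTrajectoryContent

end
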